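import Mathlib
import Literature.Probability.Percolation.PercolationProofs
import Literature.Probability.Percolation.TwoClusterConditionalAssociation
import Summits.CriticalPhenomena.PercolationContinuityZ3.Theorems.PercNearOneGluingAdditiveGluingPocketBHKCov
import Summits.CriticalPhenomena.PercolationContinuityZ3.Theorems.PercNearOneGluingAdditiveGluingBhkSets
import Summits.CriticalPhenomena.PercolationContinuityZ3.Theorems.PercNearOneGluingAdditiveGluingKnThm2GoodAux
import HarnessLib

/-! # Crux `PercNearOneGluing.AdditiveGluing` (stmt-CriticalPhenomena-4576), stub `stub_goodStep` —
# the pocket-augmented BHK inequality for the cluster of a vertex SET (tool for STUB-PLAN Line B / H9)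

Helper file for the crux (TTRL-lite variant V1431 = H9 `stub_goodStepCardFourKN` of
`Cruxes/AdditiveGluing/STUB-PLAN-stub_goodStep.md`, Line B: goodness WITH pockets for three relays in the
Kozma–Nitzan Theorem-2 regime).  Lands with `--supports stmt-CriticalPhenomena-4576`; no definitions.

**Theorem (`pocketBhkSet_integral`, `pocketBhkSet_event`; new).**  `μ = prodBernoulli w` on the bond
configurations of a finite vertex type `V`; a source SET `S`, a forbidden set `X`, an observer `o`, a family `R`
of vertex sets each containing `o` and avoiding `X` ("pockets"), `D := {S ↮ X}`,
`F := {o ↔ S} ∪ {C(o) ∈ R}` (NOT monotone), `G ≥ 0` an increasing function of the open edge cluster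
`C_S = ⋃_{s ∈ S} C_s`.  Then
    `μ(D ∩ F) · ∫_D G(C_S) dμ ≤ μ(D) · ∫_{D ∩ F} G(C_S) dμ`,
in particular (`G = 1{∀ s ∈ S, s ↔ x}`) `μ(D ∩ F) μ(D ∩ {S ⇉ x}) ≤ μ(D) μ(D ∩ F ∩ {S ⇉ x})`.
For `R = ∅` this is van den Berg–Häggström–Kahn 2006 Thm 1.3 for set sources (`stub_bhkSets`, part 1, with
`F = 1{o ↔ S}`); for a singleton `S` it is siege k9's `PocketBHK.pocketCore` / `pocket_cov_event`.
Proof: `pocketCore` (k9, file `…PocketBHK`) read through `prodBernoulli = Σ weight · δ` for a general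
increasing `G` (`pocket_cov_integral`), then the hub augmentation of `…BhkSetsAux` (a hub `none : Option V`
joined to `S` by weight-one pairs; `{o ↔ S} = {some o ↔ none}`, `{S ↮ X} = {none ↮ some '' X}`, the pockets of
`some o` are the images of the pockets of `o` (`hubCluster_some`), `C_none` pulls back to `C_S`), transported
along the law of the lift (`bhkHub_integral`).
Use (sequel files): with the two-cluster shapes obtained by COMPLEMENTING `F` on the separation event, this
single tool yields the six pocket BHK bounds and the pocket Lemma 2 of the pocket-augmented KN Theorem 2. -/

namespace Summit.CriticalPhenomena.PercolationContinuityZ3.Theorems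

namespace PocketBHK

open MeasureTheory Set
open Literature.Probability.LatticeModels (prodBernoulli)
open Literature.Probability.Percolation Literature.Probability.Percolation.BHK2006
open DecisionTree (ind ind_of_mem ind_of_not_mem ind_nonneg)
open scoped Classical

noncomputable section

variable {V : Type*} [Fintype V]

/-- **Pocket-augmented conditional association, single source, general increasing `G`** (integral form of
k9's `pocketCore` on the whole vertex set): with `D = {s ↮ X}`, `F = {o ↔ s} ∪ {C(o) ∈ R}` for pockets `R`
(each `W ∈ R` has `o ∈ W`, `s ∉ W`, `W ∩ X = ∅`) and `G ≥ 0` increasing in the open edge cluster `C_s`: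
`μ(D ∩ F) · ∫_D G(C_s) ≤ μ(D) · ∫_{D ∩ F} G(C_s)`. [folklore] -/
theorem pocket_cov_integral (w : Sym2 V → unitInterval) (s o : V) (X : Set V)
    (R : Set (Set V)) (hR : ∀ W ∈ R, o ∈ W ∧ s ∉ W ∧ ∀ x ∈ X, x ∉ W)
    (G : Set (Sym2 V) → ℝ) (hG : Monotone G) (hG0 : ∀ C, 0 ≤ G C) :
    (prodBernoulli w).real ({ω | ∀ x ∈ X, ¬ (openGraph ω).Reachable s x} ∩
        {ω | (openGraph ω).Reachable o s ∨ openCluster ω o ∈ R}) *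
      (∫ ω in {ω | ∀ x ∈ X, ¬ (openGraph ω).Reachable s x}, G (openEdgeCluster ω s)
        ∂(prodBernoulli w)) ≤
    (prodBernoulli w).real {ω | ∀ x ∈ X, ¬ (openGraph ω).Reachable s x} *
      (∫ ω in {ω | ∀ x ∈ X, ¬ (openGraph ω).Reachable s x} ∩
          {ω | (openGraph ω).Reachable o s ∨ openCluster ω o ∈ R}, G (openEdgeCluster ω s)
        ∂(prodBernoulli w)) := by
  set w' : Sym2 V → ℝ := fun e => (w e : ℝ) with hw'
  have hw0 : ∀ e, 0 ≤ w' e := fun e => (w e).2.1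
  have hw1 : ∀ e, w' e ≤ 1 := fun e => (w e).2.2
  have hm : ∑ ω, weight w' ω = 1 := by
    have h1 := integral_prodBernoulli_eq_sum w fun _ => (1 : ℝ)
    simp only [integral_const, probReal_univ, smul_eq_mul, mul_one] at h1
    exact h1.symm
  set D : Set (Set (Sym2 V)) := {ω | ∀ x ∈ X, ¬ (openGraph ω).Reachable s x} with hD
  set F : Set (Set (Sym2 V)) := {ω | (openGraph ω).Reachable o s ∨ openCluster ω o ∈ R} with hF
  have hDD : rD (Finset.univ : Finset V) s X = D := by
    ext ω; simp only [rD, inter_edgesIn_univ, hD, Set.mem_setOf_eq]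
  have hFF : {ξ : Set (Sym2 V) | (openGraph (ξ ∩ edgesIn (Finset.univ : Finset V))).Reachable o s ∨
      openCluster (ξ ∩ edgesIn (Finset.univ : Finset V)) o ∈ R} = F := by
    ext ω; simp only [inter_edgesIn_univ, hF, Set.mem_setOf_eq]
  have hC : ∀ ω, rC (Finset.univ : Finset V) s ω = openEdgeCluster ω s := fun ω => by
    simp only [rC, inter_edgesIn_univ]
  have hXU : X ⊆ ↑(Finset.univ : Finset V) := by simp
  have key := pocketCore w' hw0 hw1 hm Finset.univ s (Finset.mem_univ s) o (Finset.mem_univ o) X X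
    hXU hXU (fun W => W ∈ R) (fun W hW => hR W hW) G hG hG0
  rw [Set.inter_self, Set.union_self, hDD, hFF] at key
  simp only [hC] at key
  have e1 : ∑ ω, weight w' ω * (ind F ω * ind D ω) = (prodBernoulli w).real (D ∩ F) := by
    rw [real_eq_sum_weight_ind]
    exact Finset.sum_congr rfl fun ω _ => by rw [ind_inter]; ring
  have e4 : ∑ ω, weight w' ω * ind D ω = (prodBernoulli w).real D := by rw [real_eq_sum_weight_ind]
  have e2 : ∑ ω, weight w' ω * (G (openEdgeCluster ω s) * ind D ω) =
      ∫ ω in D, G (openEdgeCluster ω s) ∂(prodBernoulli w) := by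
    rw [← integral_indicator MeasurableSet.of_discrete, integral_prodBernoulli_eq_sum]
    refine Finset.sum_congr rfl fun ω _ => ?_
    by_cases hω : ω ∈ D
    · rw [Set.indicator_of_mem hω, ind_of_mem hω, mul_one]
    · rw [Set.indicator_of_notMem hω, ind_of_not_mem hω, mul_zero]
  have e3 : ∑ ω, weight w' ω * (ind F ω * G (openEdgeCluster ω s) * ind D ω) =
      ∫ ω in D ∩ F, G (openEdgeCluster ω s) ∂(prodBernoulli w) := by
    rw [← integral_indicator MeasurableSet.of_discrete, integral_prodBernoulli_eq_sum]
    refine Finset.sum_congr rfl fun ω _ => ?_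
    by_cases hω : ω ∈ D ∩ F
    · rw [Set.indicator_of_mem hω, ind_of_mem hω.1, ind_of_mem hω.2, one_mul, mul_one]
    · rw [Set.indicator_of_notMem hω]
      rcases not_and_or.1 hω with h | h
      · rw [ind_of_not_mem h, mul_zero]
      · rw [ind_of_not_mem h, zero_mul, zero_mul]
  rw [e1, e2, e3, e4] at key
  linarith [key]

/-! ### Hub augmentation (notation of `…BhkSetsAux`) -/

/-- `hubLift⟦A, η⟧`: the hub lift of a configuration (file-local notation for the tree term, as in the
file `…BhkSetsAux`): the old pairs of `η` through `some` plus the hub pairs `s(none, some a)`, `a ∈ A`. -/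
local notation3 (prettyPrint := false) "hubLift⟦" A ", " η "⟧" =>
  (Sym2.map some '' η ∪ {e | ∃ a ∈ A, e = s(none, some a)})

/-- `hubW⟦A, w⟧`: the augmented weights (file-local notation for the tree term, as in `…BhkSetsAux`):
`w` on the old pairs, `1` on the hub pairs `s(none, some a)`, `a ∈ A`, `0` on the other new pairs. -/
local notation3 (prettyPrint := false) "hubW⟦" A ", " w "⟧" =>
  (Function.extend (Sym2.map some) w fun e =>
    @ite unitInterval (∃ a ∈ A, e = s(none, some a)) (Classical.dec _) 1 0)

omit [Fintype V] in
/-- **The pockets of the lift.**  For `x` not joined to the attachment set, the vertex cluster of `some x` in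
the lift is the image of the cluster of `x`. [folklore] -/
theorem hubCluster_some {A : Finset V} {η : Set (Sym2 V)} {x : V}
    (hx : ¬ ∃ a ∈ A, (openGraph η).Reachable a x) :
    openCluster (hubLift⟦A, η⟧) (some x) = some '' openCluster η x := by
  ext v
  cases v with
  | none =>
    constructor
    · intro h
      exact (hx (bhkHub_reachable_none_some.1 (SimpleGraph.Reachable.symm h))).elim
    · rintro ⟨y, -, hy⟩
      exact (Option.some_ne_none y hy).elim
  | some y =>
    constructor
    · intro h
      exact ⟨y, (bhkHub_reachable_some_some hx).1 h, rfl⟩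
    · rintro ⟨y', hy', hyy'⟩
      obtain rfl : y' = y := Option.some_injective _ hyy'
      exact (bhkHub_reachable_some_some hx).2 hy'

/-- **Pocket-augmented BHK for the cluster of a vertex SET, integral form** (new): with `D = {S ↮ X}`,
`F = {o ↔ S} ∪ {C(o) ∈ R}` for pockets `R` (each `W ∈ R` has `o ∈ W`, `W ∩ X = ∅`) and `G ≥ 0` increasing
in `C_S = ⋃_{s ∈ S} C_s`: `μ(D ∩ F) · ∫_D G(C_S) ≤ μ(D) · ∫_{D ∩ F} G(C_S)`.  Proof: `pocket_cov_integral` on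
`Option V` for the hub source `none`, transported along the lift. [folklore] -/
theorem pocketBhkSet_integral (w : Sym2 V → unitInterval) (S : Finset V) (X : Set V) (o : V)
    (R : Set (Set V)) (hR : ∀ W ∈ R, o ∈ W ∧ ∀ x ∈ X, x ∉ W)
    (G : Set (Sym2 V) → ℝ) (hG : Monotone G) (hG0 : ∀ C, 0 ≤ G C) :
    (prodBernoulli w).real ({ω | ∀ s ∈ S, ∀ x ∈ X, ¬ (openGraph ω).Reachable s x} ∩
        {ω | (∃ s ∈ S, (openGraph ω).Reachable o s) ∨ openCluster ω o ∈ R}) *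
      (∫ ω in {ω | ∀ s ∈ S, ∀ x ∈ X, ¬ (openGraph ω).Reachable s x},
          G (⋃ s ∈ S, openEdgeCluster ω s) ∂(prodBernoulli w)) ≤
    (prodBernoulli w).real {ω | ∀ s ∈ S, ∀ x ∈ X, ¬ (openGraph ω).Reachable s x} *
      (∫ ω in {ω | ∀ s ∈ S, ∀ x ∈ X, ¬ (openGraph ω).Reachable s x} ∩
          {ω | (∃ s ∈ S, (openGraph ω).Reachable o s) ∨ openCluster ω o ∈ R},
          G (⋃ s ∈ S, openEdgeCluster ω s) ∂(prodBernoulli w)) := by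
  set X' : Set (Option V) := some '' X with hX'
  set R' : Set (Set (Option V)) := {W' | ∃ W ∈ R, W' = some '' W} with hR'def
  set G' : Set (Sym2 (Option V)) → ℝ := fun C => G (Sym2.map some ⁻¹' C) with hG'
  have hG'm : Monotone G' := fun C C' h => hG (preimage_mono h)
  have hG'0 : ∀ C, 0 ≤ G' C := fun C => hG0 _
  have hR'' : ∀ W' ∈ R', (some o : Option V) ∈ W' ∧ (none : Option V) ∉ W' ∧
      ∀ x ∈ X', x ∉ W' := by
    rintro W' ⟨W, hW, rfl⟩
    refine ⟨⟨o, (hR W hW).1, rfl⟩, ?_, ?_⟩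
    · rintro ⟨y, -, hy⟩
      exact Option.some_ne_none y hy
    · rintro x ⟨z, hz, rfl⟩ ⟨z', hz', hzz'⟩
      obtain rfl : z' = z := Option.some_injective _ hzz'
      exact (hR W hW).2 z' hz hz'
  have key := pocket_cov_integral hubW⟦S, w⟧ none (some o) X' R' hR'' G' hG'm hG'0
  have hL := bhkHub_integral S w
  have hD : ∀ η : Set (Sym2 V),
      hubLift⟦S, η⟧ ∈ {ω' : BondConfig (Option V) | ∀ x ∈ X', ¬ (openGraph ω').Reachable none x} ↔
        η ∈ {ω : BondConfig V | ∀ s ∈ S, ∀ x ∈ X, ¬ (openGraph ω).Reachable s x} := by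
    intro η
    simp only [mem_setOf_eq, hX', forall_mem_image, bhkHub_reachable_none_some, not_exists, not_and]
    exact ⟨fun h s hs x hx => h hx s hs, fun h x hx s hs => h s hs x hx⟩
  have hF : ∀ η : Set (Sym2 V),
      hubLift⟦S, η⟧ ∈ {ω' : BondConfig (Option V) | (openGraph ω').Reachable (some o) none ∨
          openCluster ω' (some o) ∈ R'} ↔
        η ∈ {ω : BondConfig V | (∃ s ∈ S, (openGraph ω).Reachable o s) ∨ openCluster ω o ∈ R} := by
    intro η
    simp only [mem_setOf_eq]
    by_cases h : ∃ a ∈ S, (openGraph η).Reachable a o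
    · have h1 : (openGraph hubLift⟦S, η⟧).Reachable (some o) none :=
        (bhkHub_reachable_none_some.2 h).symm
      have h2 : ∃ s ∈ S, (openGraph η).Reachable o s := by
        obtain ⟨a, ha, hao⟩ := h
        exact ⟨a, ha, hao.symm⟩
      exact ⟨fun _ => Or.inl h2, fun _ => Or.inl h1⟩
    · have h1 : ¬ (openGraph hubLift⟦S, η⟧).Reachable (some o) none := fun h' =>
        h (bhkHub_reachable_none_some.1 h'.symm)
      have h2 : ¬ ∃ s ∈ S, (openGraph η).Reachable o s := fun ⟨a, ha, hoa⟩ => h ⟨a, ha, hoa.symm⟩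
      rw [hubCluster_some h]
      simp only [h1, h2, false_or, hR'def, mem_setOf_eq]
      constructor
      · rintro ⟨W, hW, hWeq⟩
        have hCW : openCluster η o = W := (Set.image_injective.2 (Option.some_injective V)) hWeq
        rw [hCW]
        exact hW
      · intro hC
        exact ⟨_, hC, rfl⟩
  have hDF : ∀ η : Set (Sym2 V),
      hubLift⟦S, η⟧ ∈ ({ω' : BondConfig (Option V) | ∀ x ∈ X', ¬ (openGraph ω').Reachable none x} ∩
          {ω' | (openGraph ω').Reachable (some o) none ∨ openCluster ω' (some o) ∈ R'}) ↔
        η ∈ ({ω : BondConfig V | ∀ s ∈ S, ∀ x ∈ X, ¬ (openGraph ω).Reachable s x} ∩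
          {ω | (∃ s ∈ S, (openGraph ω).Reachable o s) ∨ openCluster ω o ∈ R}) := fun η => by
    rw [Set.mem_inter_iff, Set.mem_inter_iff, hD η, hF η]
  have hC : ∀ η : Set (Sym2 V),
      Sym2.map some ⁻¹' openEdgeCluster (hubLift⟦S, η⟧) none = ⋃ s ∈ S, openEdgeCluster η s :=
    bhkHub_preimage_cluster_none S
  have e1 : (prodBernoulli hubW⟦S, w⟧).real
        ({ω' : BondConfig (Option V) | ∀ x ∈ X', ¬ (openGraph ω').Reachable none x} ∩
          {ω' | (openGraph ω').Reachable (some o) none ∨ openCluster ω' (some o) ∈ R'}) =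
      (prodBernoulli w).real
        ({ω : BondConfig V | ∀ s ∈ S, ∀ x ∈ X, ¬ (openGraph ω).Reachable s x} ∩
          {ω | (∃ s ∈ S, (openGraph ω).Reachable o s) ∨ openCluster ω o ∈ R}) :=
    bhkHub_measureReal_transfer hL hDF
  have e3 : (prodBernoulli hubW⟦S, w⟧).real
        {ω' : BondConfig (Option V) | ∀ x ∈ X', ¬ (openGraph ω').Reachable none x} =
      (prodBernoulli w).real {ω : BondConfig V | ∀ s ∈ S, ∀ x ∈ X, ¬ (openGraph ω).Reachable s x} :=
    bhkHub_measureReal_transfer hL hD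
  have e2 : ∫ ω' in {ω' : BondConfig (Option V) | ∀ x ∈ X', ¬ (openGraph ω').Reachable none x},
        G' (openEdgeCluster ω' none) ∂(prodBernoulli hubW⟦S, w⟧) =
      ∫ ω in {ω : BondConfig V | ∀ s ∈ S, ∀ x ∈ X, ¬ (openGraph ω).Reachable s x},
        G (⋃ s ∈ S, openEdgeCluster ω s) ∂(prodBernoulli w) :=
    bhkHub_setIntegral_transfer hL hD fun η _ => by simp only [hG', hC]
  have e4 : ∫ ω' in {ω' : BondConfig (Option V) | ∀ x ∈ X', ¬ (openGraph ω').Reachable none x} ∩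
          {ω' | (openGraph ω').Reachable (some o) none ∨ openCluster ω' (some o) ∈ R'},
        G' (openEdgeCluster ω' none) ∂(prodBernoulli hubW⟦S, w⟧) =
      ∫ ω in {ω : BondConfig V | ∀ s ∈ S, ∀ x ∈ X, ¬ (openGraph ω).Reachable s x} ∩
          {ω | (∃ s ∈ S, (openGraph ω).Reachable o s) ∨ openCluster ω o ∈ R},
        G (⋃ s ∈ S, openEdgeCluster ω s) ∂(prodBernoulli w) :=
    bhkHub_setIntegral_transfer hL hDF fun η _ => by simp only [hG', hC]
  rw [e1, e2, e3, e4] at key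
  exact key

/-- **Pocket-augmented BHK for the cluster of a vertex SET, event form** (new): with `D = {S ↮ X}`,
`F = {o ↔ S} ∪ {C(o) ∈ R}` (pockets `R`: each member contains `o` and avoids `X`) and a target vertex `x`:
`μ(D ∩ F) · μ(D ∩ {∀ s ∈ S, s ↔ x}) ≤ μ(D) · μ(D ∩ F ∩ {∀ s ∈ S, s ↔ x})`. [folklore] -/
theorem pocketBhkSet_event (w : Sym2 V → unitInterval) (S : Finset V) (X : Set V) (o x : V)
    (R : Set (Set V)) (hR : ∀ W ∈ R, o ∈ W ∧ ∀ z ∈ X, z ∉ W) :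
    (prodBernoulli w).real ({ω | ∀ s ∈ S, ∀ z ∈ X, ¬ (openGraph ω).Reachable s z} ∩
        {ω | (∃ s ∈ S, (openGraph ω).Reachable o s) ∨ openCluster ω o ∈ R}) *
      (prodBernoulli w).real ({ω | ∀ s ∈ S, ∀ z ∈ X, ¬ (openGraph ω).Reachable s z} ∩
        ⋂ s ∈ S, openConn s x) ≤
    (prodBernoulli w).real {ω | ∀ s ∈ S, ∀ z ∈ X, ¬ (openGraph ω).Reachable s z} *
      (prodBernoulli w).real ({ω | ∀ s ∈ S, ∀ z ∈ X, ¬ (openGraph ω).Reachable s z} ∩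
        {ω | (∃ s ∈ S, (openGraph ω).Reachable o s) ∨ openCluster ω o ∈ R} ∩
        ⋂ s ∈ S, openConn s x) := by
  have key := pocketBhkSet_integral w S X o R hR
    ({C : Set (Sym2 V) | ∀ s ∈ S, (openGraph C).Reachable s x}.indicator 1)
    (knThm2_monotone_allReach S x) (fun C => Set.indicator_nonneg (fun _ _ => zero_le_one) C)
  simp only [knThm2_allReach_apply] at key
  rw [setIntegral_indicator MeasurableSet.of_discrete,
    setIntegral_indicator MeasurableSet.of_discrete] at key
  simpa only [Pi.one_apply, setIntegral_const, smul_eq_mul, mul_one] using key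

end

end PocketBHK

/-- **Registered sub-goal `stub_pocketBhkSet_v1431` of stmt-CriticalPhenomena-4576 (TTRL-lite variant V1431 /
STUB-PLAN H9): the pocket-augmented BHK inequality for the cluster of a vertex SET, event form**
(= `PocketBHK.pocketBhkSet_event`): for `μ = prodBernoulli w`, a source set `S`, a forbidden set `X`, pockets `R`
(each member contains `o` and avoids `X`), `D = {S ↮ X}`, `F = {o ↔ S} ∪ {C(o) ∈ R}` and a target `x`:
`μ(D ∩ F) μ(D ∩ {S ⇉ x}) ≤ μ(D) μ(D ∩ F ∩ {S ⇉ x})`. [folklore] -/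
theorem stub_pocketBhkSet_v1431 : ∀ (V : Type) [Fintype V] (w : Sym2 V → unitInterval) (S : Finset V) (X : Set V) (o x : V) (R : Set (Set V)), (∀ W ∈ R, o ∈ W ∧ ∀ z ∈ X, z ∉ W) → (Literature.Probability.LatticeModels.prodBernoulli w).real ({ω : Set (Sym2 V) | ∀ s ∈ S, ∀ z ∈ X, ¬ (Literature.Probability.Percolation.openGraph ω).Reachable s z} ∩ {ω : Set (Sym2 V) | (∃ s ∈ S, (Literature.Probability.Percolation.openGraph ω).Reachable o s) ∨ Literature.Probability.Percolation.openCluster ω o ∈ R}) * (Literature.Probability.LatticeModels.prodBernoulli w).real ({ω : Set (Sym2 V) | ∀ s ∈ S, ∀ z ∈ X, ¬ (Literature.Probability.Percolation.openGraph ω).Reachable s z} ∩ ⋂ s ∈ S, Literature.Probability.Percolation.openConn s x) ≤ (Literature.Probability.LatticeModels.prodBernoulli w).real {ω : Set (Sym2 V) | ∀ s ∈ S, ∀ z ∈ X, ¬ (Literature.Probability.Percolation.openGraph ω).Reachable s z} * (Literature.Probability.LatticeModels.prodBernoulli w).real ({ω : Set (Sym2 V) | ∀ s ∈ S, ∀ z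 ∈ X, ¬ (Literature.Probability.Percolation.openGraph ω).Reachable s z} ∩ {ω : Set (Sym2 V) | (∃ s ∈ S, (Literature.Probability.Percolation.openGraph ω).Reachable o s) ∨ Literature.Probability.Percolation.openCluster ω o ∈ R} ∩ ⋂ s ∈ S, Literature.Probability.Percolation.openConn s x) :=
  fun _ _ w S X o x R hR => PocketBHK.pocketBhkSet_event w S X o x R hR

end Summit.CriticalPhenomena.PercolationContinuityZ3.Theorems
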